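import Mathlib
import HarnessLib
import Summits.Ventures.LatticeQCDFlow.Scoring.ChainPathLaw
import Summits.Ventures.LatticeQCDFlow.Scoring.SplitChainDependsOn

/-!
# The Markov property with a PAST WEIGHT and a FUTURE PATH FUNCTIONAL, from any start:
# `E_{μ₀}[G(X_{≤s}) · Ψ(X_s, X_{s+1}, …)] = E_{μ₀}[G(X_{≤s}) · (E_{X_s} Ψ)]`, and the chain law as the
# `μ₀`-mixture of the laws from Dirac starts

HONEST FRAMING: exact (Metropolis-corrected) sampling algorithms for lattice gauge theory;
figures of merit are autocorrelation/cost numbers at stated couplings and volumes; no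
continuum-physics claim.

Venture `LatticeQCDFlow` (cell pub-lqcd), topic `Scoring`; FANOUT row 4 (`s0-u1-b`, GEN-30).
NEW WORK of the cell (elementary; our formalisation), not a published result; no definition is
introduced; nothing is cited as a fact (the Markov property of the canonical chain — e.g.
Revuz 1984 Ch. 1, Meyn–Tweedie 1993 §3.4 — NAMED ONLY).  The chain-level files of the venture
speak about the path law `P_{μ₀}` (`Kernel.trajMeasure` of the constant kernel family) through the
ONE-STEP tower property with a history functional (`Scoring/ChainTimeAverage.chain_tower`,
`Scoring/SplitChainDependsOn.chain_tower_dependsOn`) and its iterate for ONE future observation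
(`chain_tower_iterate_dependsOn`); the block arguments of the batch-means files peel future times one
by one.  The sampling law of the batch-means ESTIMATOR (row 4's `τ_int` column: the CLT for
`σ̂²_{a,b}`, `Scoring/BatchMeansCLT*.lean`) needs block functionals of a whole future segment —
conditional centring of `V_j = Ψ(X_{bj}, X_{bj+1}, …)` at `E_{X_{bj}} Ψ` and orthogonality of the
centred blocks.  This file proves the general statement once:

* **`chain_integral_eq_integral_dirac`** — `∫ Ψ dP_{μ₀} = ∫ (∫ Ψ dP_{δ_z}) dμ₀(z)` for bounded
  measurable `Ψ` (the definition `trajMeasure μ₀ = traj 0 ∘ₘ μ₀`, Mathlib's `Kernel.integral_comp`),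
  with `z ↦ ∫ Ψ dP_{δ_z}` measurable (`measurable_chain_dirac_integral`) and bounded;
* **`chain_markov_dependsOn`** — THE MARKOV PROPERTY: for bounded measurable `G` with
  `DependsOn G (Set.Iic s)` and bounded measurable `Ψ`,
  `∫ G(x) Ψ(n ↦ x(s+n)) dP_{μ₀} = ∫ G(x) (∫ Ψ dP_{δ_{x s}}) dP_{μ₀}`.
  Proof: for `G ≥ 1` the normalised measure `Q = c⁻¹ (G · P_{μ₀}) ∘ θ_s⁻¹` (`c = ∫ G`) has time-`0`
  marginal `μ_G = c⁻¹ (G · P_{μ₀}) ∘ X_s⁻¹` and satisfies the one-step tower identities of `κ`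
  (by `chain_tower_dependsOn` at time `s + a` with the history functional `G · F(x_s, …, x_{s+a})`),
  so `Q = P_{μ_G}` by the tree's UNIQUENESS OF THE CHAIN LAW (`Scoring/ChainPathLaw.eq_chain_of_tower`);
  integrate `Ψ` against both sides and disintegrate `P_{μ_G}` over `μ_G`; a general `G` is a
  difference of two such weights;
* **`chain_shift_centred_orthogonal`** — consequently `∫ G(x) (Ψ(θ_s x) − E_{x s} Ψ) dP_{μ₀} = 0`:
  a block functional centred at its conditional mean is orthogonal to the past — the martingale
  structure ACROSS blocks used by the batch-means CLT.

NOT CLAIMED: random (stopping) times — the strong Markov property at regeneration times is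
`Scoring/SplitChainStrongMarkov.lean`; unbounded functionals.
-/

noncomputable section

namespace Summit.Ventures.LatticeQCDFlow.Scoring

open MeasureTheory ProbabilityTheory Filter Finset Preorder
open scoped ENNReal Topology NNReal

variable {Ω : Type*} [MeasurableSpace Ω]

section Chain

variable (κ : Kernel Ω Ω) [IsMarkovKernel κ]

/-! ### The chain law as a mixture over the initial law -/

/-- From a Dirac start the chain law is the Ionescu-Tulcea kernel at the one-point history. -/
theorem chain_dirac_eq_traj (z : Ω) :
    (Kernel.trajMeasure (X := fun _ : ℕ => Ω) (Measure.dirac z)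
          (fun n : ℕ => κ.comap (fun h : (i : ↥(Finset.Iic n)) → Ω => h ⟨n, Finset.mem_Iic.2 le_rfl⟩)
            (measurable_pi_apply _))) = Kernel.traj (X := fun _ : ℕ => Ω)
      (fun n : ℕ => κ.comap (fun h : (i : ↥(Finset.Iic n)) → Ω => h ⟨n, Finset.mem_Iic.2 le_rfl⟩)
        (measurable_pi_apply _)) 0
      ((MeasurableEquiv.piUnique (fun _ : ↥(Finset.Iic 0) => Ω)).symm z) := by
  rw [Kernel.trajMeasure, Measure.map_dirac' (MeasurableEquiv.measurable _),
    Measure.dirac_bind (Kernel.measurable _)]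

/-- **`z ↦ E_z[Ψ]` is measurable** for measurable `Ψ`. -/
theorem measurable_chain_dirac_integral {Ψ : (ℕ → Ω) → ℝ} (hΨ : Measurable Ψ) :
    Measurable fun z : Ω => ∫ y, Ψ y ∂(Kernel.trajMeasure (X := fun _ : ℕ => Ω) (Measure.dirac z)
          (fun n : ℕ => κ.comap (fun h : (i : ↥(Finset.Iic n)) → Ω => h ⟨n, Finset.mem_Iic.2 le_rfl⟩)
            (measurable_pi_apply _))) := by
  simp_rw [chain_dirac_eq_traj κ]
  exact (hΨ.stronglyMeasurable.integral_kernel).measurable.comp (MeasurableEquiv.measurable _)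

/-- `|E_z[Ψ]| ≤ C_Ψ`. -/
theorem abs_chain_dirac_integral_le {Ψ : (ℕ → Ω) → ℝ} {CΨ : ℝ} (hΨb : ∀ y, |Ψ y| ≤ CΨ) (z : Ω) :
    |∫ y, Ψ y ∂(Kernel.trajMeasure (X := fun _ : ℕ => Ω) (Measure.dirac z)
          (fun n : ℕ => κ.comap (fun h : (i : ↥(Finset.Iic n)) → Ω => h ⟨n, Finset.mem_Iic.2 le_rfl⟩)
            (measurable_pi_apply _)))| ≤ CΨ := by
  have h := norm_integral_le_of_norm_le_const (μ := (Kernel.trajMeasure (X := fun _ : ℕ => Ω) (Measure.dirac z)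
        (fun n : ℕ => κ.comap (fun h : (i : ↥(Finset.Iic n)) → Ω => h ⟨n, Finset.mem_Iic.2 le_rfl⟩)
          (measurable_pi_apply _)))) (f := Ψ) (C := CΨ)
    (Eventually.of_forall fun y => by rw [Real.norm_eq_abs]; exact hΨb y)
  rwa [Real.norm_eq_abs, probReal_univ, mul_one] at h

/-- **THE CHAIN LAW IS THE `μ₀`-MIXTURE OF THE LAWS FROM DIRAC STARTS**: for bounded measurable `Ψ`,
`∫ Ψ dP_{μ₀} = ∫ (∫ Ψ dP_{δ_z}) dμ₀(z)`. -/
theorem chain_integral_eq_integral_dirac (μ₀ : Measure Ω) [IsProbabilityMeasure μ₀]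
    {Ψ : (ℕ → Ω) → ℝ} (hΨ : Measurable Ψ) {CΨ : ℝ} (hΨb : ∀ y, |Ψ y| ≤ CΨ) :
    ∫ y, Ψ y ∂(Kernel.trajMeasure (X := fun _ : ℕ => Ω) (μ₀)
          (fun n : ℕ => κ.comap (fun h : (i : ↥(Finset.Iic n)) → Ω => h ⟨n, Finset.mem_Iic.2 le_rfl⟩)
            (measurable_pi_apply _))) = ∫ z, (∫ y, Ψ y ∂(Kernel.trajMeasure (X := fun _ : ℕ => Ω) (Measure.dirac z)
          (fun n : ℕ => κ.comap (fun h : (i : ↥(Finset.Iic n)) → Ω => h ⟨n, Finset.mem_Iic.2 le_rfl⟩)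
            (measurable_pi_apply _)))) ∂μ₀ := by
  simp_rw [chain_dirac_eq_traj κ]
  have hT : StronglyMeasurable fun u : (i : ↥(Finset.Iic 0)) → Ω => ∫ y, Ψ y ∂(Kernel.traj
      (X := fun _ : ℕ => Ω) (fun n : ℕ => κ.comap (fun h : (i : ↥(Finset.Iic n)) → Ω =>
        h ⟨n, Finset.mem_Iic.2 le_rfl⟩) (measurable_pi_apply _)) 0 u) :=
    hΨ.stronglyMeasurable.integral_kernel
  haveI : IsProbabilityMeasure
      (μ₀.map (MeasurableEquiv.piUnique (fun _ : ↥(Finset.Iic 0) => Ω)).symm) :=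
    Measure.isProbabilityMeasure_map (MeasurableEquiv.measurable _).aemeasurable
  have hint : Integrable Ψ (Kernel.trajMeasure (X := fun _ : ℕ => Ω) (μ₀)
        (fun n : ℕ => κ.comap (fun h : (i : ↥(Finset.Iic n)) → Ω => h ⟨n, Finset.mem_Iic.2 le_rfl⟩)
          (measurable_pi_apply _))) := integrable_of_bounded _ hΨ hΨb
  rw [Kernel.trajMeasure] at hint ⊢
  rw [Measure.comp_eq_comp_const_apply] at hint ⊢
  rw [Kernel.integral_comp hint, Kernel.const_apply,
    integral_map (MeasurableEquiv.measurable _).aemeasurable hT.aestronglyMeasurable]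

/-! ### The Markov property with a past weight and a future path functional -/

/-- The positive case: `1 ≤ G ≤ C_G`. -/
theorem chain_markov_dependsOn_of_one_le (μ₀ : Measure Ω) [IsProbabilityMeasure μ₀] (s : ℕ)
    {G : (ℕ → Ω) → ℝ} (hG : Measurable G) (hGd : DependsOn G (Set.Iic s)) {CG : ℝ}
    (hCG : ∀ x, |G x| ≤ CG) (hG1 : ∀ x, 1 ≤ G x)
    {Ψ : (ℕ → Ω) → ℝ} (hΨ : Measurable Ψ) {CΨ : ℝ} (hΨb : ∀ y, |Ψ y| ≤ CΨ) :
    ∫ x, G x * Ψ (fun n => x (s + n)) ∂(Kernel.trajMeasure (X := fun _ : ℕ => Ω) (μ₀)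
          (fun n : ℕ => κ.comap (fun h : (i : ↥(Finset.Iic n)) → Ω => h ⟨n, Finset.mem_Iic.2 le_rfl⟩)
            (measurable_pi_apply _)))
      = ∫ x, G x * (∫ y, Ψ y ∂(Kernel.trajMeasure (X := fun _ : ℕ => Ω) (Measure.dirac (x s))
            (fun n : ℕ => κ.comap (fun h : (i : ↥(Finset.Iic n)) → Ω => h ⟨n, Finset.mem_Iic.2 le_rfl⟩)
              (measurable_pi_apply _)))) ∂(Kernel.trajMeasure (X := fun _ : ℕ => Ω) (μ₀)
            (fun n : ℕ => κ.comap (fun h : (i : ↥(Finset.Iic n)) → Ω => h ⟨n, Finset.mem_Iic.2 le_rfl⟩)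
              (measurable_pi_apply _))) := by
  set P := (Kernel.trajMeasure (X := fun _ : ℕ => Ω) (μ₀)
        (fun n : ℕ => κ.comap (fun h : (i : ↥(Finset.Iic n)) → Ω => h ⟨n, Finset.mem_Iic.2 le_rfl⟩)
          (measurable_pi_apply _))) with hP
  have hθ : Measurable (fun (x : ℕ → Ω) (n : ℕ) => x (s + n)) :=
    measurable_pi_lambda _ fun n => measurable_pi_apply _
  have hρm : Measurable fun x : ℕ → Ω => (G x).toNNReal := hG.real_toNNReal
  have hG0 : ∀ x, 0 ≤ G x := fun x => zero_le_one.trans (hG1 x)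
  set ν : Measure (ℕ → Ω) := P.withDensity (fun x => ((G x).toNNReal : ℝ≥0∞)) with hν
  set c : ℝ := ∫ x, G x ∂P with hc
  have hGint : Integrable G P := integrable_of_bounded P hG hCG
  have hc1 : 1 ≤ c := by
    rw [hc]
    calc (1 : ℝ) = ∫ _x, (1 : ℝ) ∂P := by simp
      _ ≤ ∫ x, G x ∂P := integral_mono (integrable_const _) hGint hG1
  have hc0 : 0 < c := by linarith
  set Q : Measure (ℕ → Ω) :=
    (ENNReal.ofReal c)⁻¹ • ν.map (fun (x : ℕ → Ω) (n : ℕ) => x (s + n)) with hQ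
  set μG : Measure Ω := (ENNReal.ofReal c)⁻¹ • ν.map (fun x : ℕ → Ω => x s) with hμG
  have htoReal : ((ENNReal.ofReal c)⁻¹).toReal = c⁻¹ := by
    rw [ENNReal.toReal_inv, ENNReal.toReal_ofReal hc0.le]
  -- (1) integrals against `Q` and `μG`
  have hF1 : ∀ {f : (ℕ → Ω) → ℝ}, Measurable f →
      ∫ y, f y ∂Q = c⁻¹ * ∫ x, G x * f (fun n => x (s + n)) ∂P := by
    intro f hf
    rw [hQ, integral_smul_measure, integral_map hθ.aemeasurable hf.aestronglyMeasurable, hν,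
      integral_withDensity_eq_integral_smul hρm, smul_eq_mul, htoReal]
    congr 1
    refine integral_congr_ae (ae_of_all _ fun x => ?_)
    dsimp only
    rw [NNReal.smul_def, smul_eq_mul, Real.coe_toNNReal _ (hG0 x)]
  have hF1' : ∀ {g : Ω → ℝ}, Measurable g →
      ∫ z, g z ∂μG = c⁻¹ * ∫ x, G x * g (x s) ∂P := by
    intro g hg
    rw [hμG, integral_smul_measure, integral_map (measurable_pi_apply s).aemeasurable
      hg.aestronglyMeasurable, hν, integral_withDensity_eq_integral_smul hρm, smul_eq_mul, htoReal]
    congr 1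
    refine integral_congr_ae (ae_of_all _ fun x => ?_)
    dsimp only
    rw [NNReal.smul_def, smul_eq_mul, Real.coe_toNNReal _ (hG0 x)]
  -- (2) both are probability measures
  have hν_univ : ν Set.univ = ENNReal.ofReal c := by
    rw [hν, withDensity_apply _ MeasurableSet.univ, Measure.restrict_univ, hc,
      ofReal_integral_eq_lintegral_ofReal hGint (ae_of_all _ hG0)]
    rfl
  have hcinv : (ENNReal.ofReal c)⁻¹ * ENNReal.ofReal c = 1 :=
    ENNReal.inv_mul_cancel (ENNReal.ofReal_pos.2 hc0).ne' ENNReal.ofReal_ne_top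
  haveI hQprob : IsProbabilityMeasure Q := ⟨by
    rw [hQ, Measure.smul_apply, Measure.map_apply hθ MeasurableSet.univ, Set.preimage_univ,
      hν_univ, smul_eq_mul, hcinv]⟩
  haveI hμGprob : IsProbabilityMeasure μG := ⟨by
    rw [hμG, Measure.smul_apply, Measure.map_apply (measurable_pi_apply s) MeasurableSet.univ,
      Set.preimage_univ, hν_univ, smul_eq_mul, hcinv]⟩
  -- (3) time-`0` marginal of `Q`
  have h0 : Q.map (fun y : ℕ → Ω => y 0) = μG := by
    rw [hQ, Measure.map_smul, Measure.map_map (measurable_pi_apply 0) hθ]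
    rfl
  -- (4) the one-step tower identities of `κ` under `Q`
  have hstep : ∀ (a : ℕ) {F : ((i : ↥(Finset.Iic a)) → Ω) → ℝ}, Measurable F → ∀ {CF : ℝ},
      (∀ h, |F h| ≤ CF) → ∀ {g : Ω → ℝ}, Measurable g → ∀ {Cg : ℝ}, (∀ x, |g x| ≤ Cg) →
      ∫ y, F (frestrictLe a y) * g (y (a + 1)) ∂Q
        = ∫ y, F (frestrictLe a y) * kop κ g (y a) ∂Q := by
    intro a F hF CF hCF g hg Cg hCg
    have hCF0 : 0 ≤ CF := (abs_nonneg _).trans (hCF (fun _ => Classical.choice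
      (nonempty_of_isProbabilityMeasure μ₀)))
    have hCG0 : 0 ≤ CG := (abs_nonneg _).trans (hCG (fun _ => Classical.choice
      (nonempty_of_isProbabilityMeasure μ₀)))
    have hm1 : Measurable fun y : ℕ → Ω => F (frestrictLe a y) * g (y (a + 1)) :=
      (hF.comp (measurable_frestrictLe a)).mul (hg.comp (measurable_pi_apply _))
    have hm2 : Measurable fun y : ℕ → Ω => F (frestrictLe a y) * kop κ g (y a) :=
      (hF.comp (measurable_frestrictLe a)).mul ((measurable_kop κ hg).comp (measurable_pi_apply _))
    rw [hF1 hm1, hF1 hm2]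
    congr 1
    -- the history functional `G · F(x_s, …, x_{s+a})` at time `s + a`
    have hHm : Measurable fun x : ℕ → Ω => G x * F (fun i : ↥(Finset.Iic a) => x (s + i)) :=
      hG.mul (hF.comp (measurable_pi_lambda _ fun i => measurable_pi_apply _))
    have hHd : DependsOn (fun x : ℕ → Ω => G x * F (fun i : ↥(Finset.Iic a) => x (s + i)))
        (Set.Iic (s + a)) := by
      intro x y hxy
      have h1 : G x = G y := hGd fun i hi => hxy i (Set.mem_Iic.2 ((Set.mem_Iic.1 hi).trans
        (Nat.le_add_right s a)))
      have h2 : (fun i : ↥(Finset.Iic a) => x (s + i)) = fun i : ↥(Finset.Iic a) => y (s + i) := by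
        funext i
        exact hxy (s + i) (Set.mem_Iic.2 (Nat.add_le_add_left (Finset.mem_Iic.1 i.2) s))
      show G x * F (fun i : ↥(Finset.Iic a) => x (s + i)) = G y * F (fun i => y (s + i))
      rw [h1, h2]
    have hHb : ∀ x : ℕ → Ω, |G x * F (fun i : ↥(Finset.Iic a) => x (s + i))| ≤ CG * CF :=
      fun x => by rw [abs_mul]; exact mul_le_mul (hCG x) (hCF _) (abs_nonneg _) hCG0
    have key := chain_tower_dependsOn κ μ₀ (s + a) hHm hHd hHb hg hCg
    rw [← hP] at key
    have e1 : ∀ x : ℕ → Ω, G x * (F (frestrictLe a (fun n => x (s + n))) * g (x (s + (a + 1))))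
        = G x * F (fun i : ↥(Finset.Iic a) => x (s + i)) * g (x (s + a + 1)) := fun x => by
      rw [mul_assoc]; rfl
    have e2 : ∀ x : ℕ → Ω, G x * (F (frestrictLe a (fun n => x (s + n))) * kop κ g (x (s + a)))
        = G x * F (fun i : ↥(Finset.Iic a) => x (s + i)) * kop κ g (x (s + a)) := fun x => by
      rw [mul_assoc]; rfl
    simp_rw [e1, e2]
    exact key
  -- (5) uniqueness of the chain law
  have hQeq : Q = (Kernel.trajMeasure (X := fun _ : ℕ => Ω) (μG)
        (fun n : ℕ => κ.comap (fun h : (i : ↥(Finset.Iic n)) → Ω => h ⟨n, Finset.mem_Iic.2 le_rfl⟩)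
          (measurable_pi_apply _))) := eq_chain_of_tower κ μG Q h0 hstep
  -- (6) integrate `Ψ` against both descriptions of `Q`
  have hEz_m : Measurable fun z : Ω => ∫ y, Ψ y ∂(Kernel.trajMeasure (X := fun _ : ℕ => Ω) (Measure.dirac z)
        (fun n : ℕ => κ.comap (fun h : (i : ↥(Finset.Iic n)) → Ω => h ⟨n, Finset.mem_Iic.2 le_rfl⟩)
          (measurable_pi_apply _))) :=
    measurable_chain_dirac_integral κ hΨ
  have lhs : ∫ y, Ψ y ∂Q = c⁻¹ * ∫ x, G x * Ψ (fun n => x (s + n)) ∂P := hF1 hΨ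
  have rhs : ∫ y, Ψ y ∂Q = c⁻¹ * ∫ x, G x * (∫ y, Ψ y ∂(Kernel.trajMeasure (X := fun _ : ℕ => Ω) (Measure.dirac (x s))
        (fun n : ℕ => κ.comap (fun h : (i : ↥(Finset.Iic n)) → Ω => h ⟨n, Finset.mem_Iic.2 le_rfl⟩)
          (measurable_pi_apply _)))) ∂P := by
    rw [hQeq, chain_integral_eq_integral_dirac κ μG hΨ hΨb, hF1' hEz_m]
  exact mul_left_cancel₀ (inv_ne_zero hc0.ne') (lhs.symm.trans rhs)

/-- **THE MARKOV PROPERTY WITH A PAST WEIGHT AND A FUTURE PATH FUNCTIONAL, FROM ANY START.**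
For bounded measurable `G` with `DependsOn G (Set.Iic s)` and bounded measurable `Ψ`:
`∫ G(x) · Ψ(n ↦ x (s + n)) dP_{μ₀} = ∫ G(x) · (∫ Ψ dP_{δ_{x s}}) dP_{μ₀}`. -/
theorem chain_markov_dependsOn (μ₀ : Measure Ω) [IsProbabilityMeasure μ₀] (s : ℕ)
    {G : (ℕ → Ω) → ℝ} (hG : Measurable G) (hGd : DependsOn G (Set.Iic s)) {CG : ℝ}
    (hCG : ∀ x, |G x| ≤ CG)
    {Ψ : (ℕ → Ω) → ℝ} (hΨ : Measurable Ψ) {CΨ : ℝ} (hΨb : ∀ y, |Ψ y| ≤ CΨ) :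
    ∫ x, G x * Ψ (fun n => x (s + n)) ∂(Kernel.trajMeasure (X := fun _ : ℕ => Ω) (μ₀)
          (fun n : ℕ => κ.comap (fun h : (i : ↥(Finset.Iic n)) → Ω => h ⟨n, Finset.mem_Iic.2 le_rfl⟩)
            (measurable_pi_apply _)))
      = ∫ x, G x * (∫ y, Ψ y ∂(Kernel.trajMeasure (X := fun _ : ℕ => Ω) (Measure.dirac (x s))
            (fun n : ℕ => κ.comap (fun h : (i : ↥(Finset.Iic n)) → Ω => h ⟨n, Finset.mem_Iic.2 le_rfl⟩)
              (measurable_pi_apply _)))) ∂(Kernel.trajMeasure (X := fun _ : ℕ => Ω) (μ₀)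
            (fun n : ℕ => κ.comap (fun h : (i : ↥(Finset.Iic n)) → Ω => h ⟨n, Finset.mem_Iic.2 le_rfl⟩)
              (measurable_pi_apply _))) := by
  set P := (Kernel.trajMeasure (X := fun _ : ℕ => Ω) (μ₀)
        (fun n : ℕ => κ.comap (fun h : (i : ↥(Finset.Iic n)) → Ω => h ⟨n, Finset.mem_Iic.2 le_rfl⟩)
          (measurable_pi_apply _))) with hP
  have hCG0 : 0 ≤ CG := (abs_nonneg _).trans (hCG (fun _ => Classical.choice
    (nonempty_of_isProbabilityMeasure μ₀)))
  have hCΨ0 : 0 ≤ CΨ := (abs_nonneg _).trans (hΨb (fun _ => Classical.choice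
    (nonempty_of_isProbabilityMeasure μ₀)))
  -- `G = (G + C_G + 1) − (C_G + 1)`, both weights `≥ 1`
  have hA := chain_markov_dependsOn_of_one_le κ μ₀ s (G := fun x => G x + (CG + 1))
    (hG.add_const _) (fun x y hxy => by show G x + (CG + 1) = G y + (CG + 1); rw [hGd hxy])
    (CG := 2 * CG + 1) (fun x => by
      have := hCG x; rw [abs_le] at this ⊢; constructor <;> linarith)
    (fun x => by have := hCG x; rw [abs_le] at this; linarith) hΨ hΨb
  have hB := chain_markov_dependsOn_of_one_le κ μ₀ s (G := fun _ => CG + 1)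
    measurable_const (dependsOn_const _ |>.mono (Set.empty_subset _)) (CG := CG + 1)
    (fun x => by rw [abs_of_nonneg (by linarith)]) (fun x => by linarith) hΨ hΨb
  rw [← hP] at hA hB
  have hθ : Measurable (fun (x : ℕ → Ω) (n : ℕ) => x (s + n)) :=
    measurable_pi_lambda _ fun n => measurable_pi_apply _
  have hΨθ : Measurable fun x : ℕ → Ω => Ψ (fun n => x (s + n)) := hΨ.comp hθ
  have hEz_m : Measurable fun x : ℕ → Ω => ∫ y, Ψ y ∂(Kernel.trajMeasure (X := fun _ : ℕ => Ω) (Measure.dirac (x s))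
        (fun n : ℕ => κ.comap (fun h : (i : ↥(Finset.Iic n)) → Ω => h ⟨n, Finset.mem_Iic.2 le_rfl⟩)
          (measurable_pi_apply _))) :=
    (measurable_chain_dirac_integral κ hΨ).comp (measurable_pi_apply s)
  have hEz_b : ∀ x : ℕ → Ω, |∫ y, Ψ y ∂(Kernel.trajMeasure (X := fun _ : ℕ => Ω) (Measure.dirac (x s))
        (fun n : ℕ => κ.comap (fun h : (i : ↥(Finset.Iic n)) → Ω => h ⟨n, Finset.mem_Iic.2 le_rfl⟩)
          (measurable_pi_apply _)))| ≤ CΨ := fun x =>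
    abs_chain_dirac_integral_le κ hΨb (x s)
  -- integrability of the four products
  have iA1 : Integrable (fun x : ℕ → Ω => (G x + (CG + 1)) * Ψ (fun n => x (s + n))) P :=
    integrable_of_bounded P ((hG.add_const _).mul hΨθ) (C := (2 * CG + 1) * CΨ) fun x => by
      rw [abs_mul]
      refine mul_le_mul ?_ (hΨb _) (abs_nonneg _) (by linarith)
      have := hCG x; rw [abs_le] at this ⊢; constructor <;> linarith
  have iB1 : Integrable (fun x : ℕ → Ω => (CG + 1) * Ψ (fun n => x (s + n))) P :=
    integrable_of_bounded P (measurable_const.mul hΨθ) (C := (CG + 1) * CΨ) fun x => by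
      rw [abs_mul, abs_of_nonneg (by linarith : (0 : ℝ) ≤ CG + 1)]
      exact mul_le_mul_of_nonneg_left (hΨb _) (by linarith)
  have iA2 : Integrable (fun x : ℕ → Ω => (G x + (CG + 1)) *
      ∫ y, Ψ y ∂(Kernel.trajMeasure (X := fun _ : ℕ => Ω) (Measure.dirac (x s))
            (fun n : ℕ => κ.comap (fun h : (i : ↥(Finset.Iic n)) → Ω => h ⟨n, Finset.mem_Iic.2 le_rfl⟩)
              (measurable_pi_apply _)))) P :=
    integrable_of_bounded P ((hG.add_const _).mul hEz_m) (C := (2 * CG + 1) * CΨ) fun x => by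
      rw [abs_mul]
      refine mul_le_mul ?_ (hEz_b x) (abs_nonneg _) (by linarith)
      have := hCG x; rw [abs_le] at this ⊢; constructor <;> linarith
  have iB2 : Integrable (fun x : ℕ → Ω => (CG + 1) * ∫ y, Ψ y ∂(Kernel.trajMeasure (X := fun _ : ℕ => Ω) (Measure.dirac (x s))
        (fun n : ℕ => κ.comap (fun h : (i : ↥(Finset.Iic n)) → Ω => h ⟨n, Finset.mem_Iic.2 le_rfl⟩)
          (measurable_pi_apply _)))) P :=
    integrable_of_bounded P (measurable_const.mul hEz_m) (C := (CG + 1) * CΨ) fun x => by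
      rw [abs_mul, abs_of_nonneg (by linarith : (0 : ℝ) ≤ CG + 1)]
      exact mul_le_mul_of_nonneg_left (hEz_b x) (by linarith)
  have eL : ∀ x : ℕ → Ω, G x * Ψ (fun n => x (s + n))
      = (G x + (CG + 1)) * Ψ (fun n => x (s + n)) - (CG + 1) * Ψ (fun n => x (s + n)) :=
    fun x => by ring
  have eR : ∀ x : ℕ → Ω, G x * ∫ y, Ψ y ∂(Kernel.trajMeasure (X := fun _ : ℕ => Ω) (Measure.dirac (x s))
        (fun n : ℕ => κ.comap (fun h : (i : ↥(Finset.Iic n)) → Ω => h ⟨n, Finset.mem_Iic.2 le_rfl⟩)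
          (measurable_pi_apply _)))
      = (G x + (CG + 1)) * (∫ y, Ψ y ∂(Kernel.trajMeasure (X := fun _ : ℕ => Ω) (Measure.dirac (x s))
            (fun n : ℕ => κ.comap (fun h : (i : ↥(Finset.Iic n)) → Ω => h ⟨n, Finset.mem_Iic.2 le_rfl⟩)
              (measurable_pi_apply _))))
        - (CG + 1) * ∫ y, Ψ y ∂(Kernel.trajMeasure (X := fun _ : ℕ => Ω) (Measure.dirac (x s))
              (fun n : ℕ => κ.comap (fun h : (i : ↥(Finset.Iic n)) → Ω => h ⟨n, Finset.mem_Iic.2 le_rfl⟩)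
                (measurable_pi_apply _))) := fun x => by ring
  rw [integral_congr_ae (ae_of_all _ eL), integral_congr_ae (ae_of_all _ eR),
    integral_sub iA1 iB1, integral_sub iA2 iB2, hA, hB]

/-- **A FUTURE BLOCK FUNCTIONAL CENTRED AT ITS CONDITIONAL MEAN IS ORTHOGONAL TO THE PAST**:
`∫ G(x) · (Ψ(n ↦ x(s+n)) − ∫ Ψ dP_{δ_{x s}}) dP_{μ₀} = 0` for bounded measurable `G` with
`DependsOn G (Set.Iic s)` and bounded measurable `Ψ`. -/
theorem chain_shift_centred_orthogonal (μ₀ : Measure Ω) [IsProbabilityMeasure μ₀] (s : ℕ)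
    {G : (ℕ → Ω) → ℝ} (hG : Measurable G) (hGd : DependsOn G (Set.Iic s)) {CG : ℝ}
    (hCG : ∀ x, |G x| ≤ CG)
    {Ψ : (ℕ → Ω) → ℝ} (hΨ : Measurable Ψ) {CΨ : ℝ} (hΨb : ∀ y, |Ψ y| ≤ CΨ) :
    ∫ x, G x * (Ψ (fun n => x (s + n)) - ∫ y, Ψ y ∂(Kernel.trajMeasure (X := fun _ : ℕ => Ω) (Measure.dirac (x s))
          (fun n : ℕ => κ.comap (fun h : (i : ↥(Finset.Iic n)) → Ω => h ⟨n, Finset.mem_Iic.2 le_rfl⟩)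
            (measurable_pi_apply _)))) ∂(Kernel.trajMeasure (X := fun _ : ℕ => Ω) (μ₀)
          (fun n : ℕ => κ.comap (fun h : (i : ↥(Finset.Iic n)) → Ω => h ⟨n, Finset.mem_Iic.2 le_rfl⟩)
            (measurable_pi_apply _))) = 0 := by
  set P := (Kernel.trajMeasure (X := fun _ : ℕ => Ω) (μ₀)
        (fun n : ℕ => κ.comap (fun h : (i : ↥(Finset.Iic n)) → Ω => h ⟨n, Finset.mem_Iic.2 le_rfl⟩)
          (measurable_pi_apply _))) with hP
  have hCG0 : 0 ≤ CG := (abs_nonneg _).trans (hCG (fun _ => Classical.choice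
    (nonempty_of_isProbabilityMeasure μ₀)))
  have hθ : Measurable (fun (x : ℕ → Ω) (n : ℕ) => x (s + n)) :=
    measurable_pi_lambda _ fun n => measurable_pi_apply _
  have hEz_m : Measurable fun x : ℕ → Ω => ∫ y, Ψ y ∂(Kernel.trajMeasure (X := fun _ : ℕ => Ω) (Measure.dirac (x s))
        (fun n : ℕ => κ.comap (fun h : (i : ↥(Finset.Iic n)) → Ω => h ⟨n, Finset.mem_Iic.2 le_rfl⟩)
          (measurable_pi_apply _))) :=
    (measurable_chain_dirac_integral κ hΨ).comp (measurable_pi_apply s)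
  have i1 : Integrable (fun x : ℕ → Ω => G x * Ψ (fun n => x (s + n))) P :=
    integrable_of_bounded P (hG.mul (hΨ.comp hθ)) (C := CG * CΨ) fun x => by
      rw [abs_mul]; exact mul_le_mul (hCG x) (hΨb _) (abs_nonneg _) hCG0
  have i2 : Integrable (fun x : ℕ → Ω => G x * ∫ y, Ψ y ∂(Kernel.trajMeasure (X := fun _ : ℕ => Ω) (Measure.dirac (x s))
        (fun n : ℕ => κ.comap (fun h : (i : ↥(Finset.Iic n)) → Ω => h ⟨n, Finset.mem_Iic.2 le_rfl⟩)
          (measurable_pi_apply _)))) P :=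
    integrable_of_bounded P (hG.mul hEz_m) (C := CG * CΨ) fun x => by
      rw [abs_mul]
      exact mul_le_mul (hCG x) (abs_chain_dirac_integral_le κ hΨb (x s)) (abs_nonneg _) hCG0
  have key := chain_markov_dependsOn κ μ₀ s hG hGd hCG hΨ hΨb
  rw [← hP] at key
  simp_rw [mul_sub]
  rw [integral_sub i1 i2, key, sub_self]

end Chain

end Summit.Ventures.LatticeQCDFlow.Scoring

end
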